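/-
Copyright: the b2b-balaban cell (near-miss cell 7), T⁴-continuum fan-out; row NE7b ROUND-2 swarm, seat
t4-ne7b-formalise-leaf-05 gen 3 (row S6g′ INSTANCE of `t4/b2b-balaban-t4-ne7b-p1/LEAVES-NE7b.md`, owner's ruling
R-OWNER-22-23: T3a).  Released under the licence of the surrounding project.
-/
import Summits.QuantumFields.BalabanUV.T4Continuum.Support.HistoryJoinsRadius

/-!
# History joins: NON-HOST bookkeeping — the non-host roots are the non-root births, and the radius-factor product is a
# product over NON-HOST parts only (row S6g′ INSTANCE, T3a prerequisite)

Summits-side support leaf of the T⁴-continuum cell (rung (B)+1 on a FINITE torus only; NOT infinite volume, NOT the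
mass gap, NOT the Clay statement; NOT a proof of the spine estimate NE7b).  Row NE7b, route «COUNT», row S6g′.
[folklore] well-founded recursion over the lineage's own carrier (`HistoryJoins*`); nothing is quoted from print,
nothing printed is asserted, no `[cite:]` tag, no `Prop` fact minted (the one definition is a real-valued SUM).

WHY.  The instance's placement datum of a birth is its anchor cell AND its region template (T3a); the template of the
ROOT of every NON-HOST part enters the radius side of the count (`HistoryJoinsBudget.MρP`, through the witness radius
`δ ≥ |template| − 1` of the root datum), so the extent law at the joins carries an extra potential `fat (root P) + 1`
per non-host part `P`.  Its total is class-linear because THE ROOTS OF THE NON-HOST PARTS, OVER ALL JOINS, ARE EXACTLY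
THE NON-ROOT BIRTHS (with multiplicity): §2 `sum_joins_nhsum_root_add`.  And `MρP` itself has radius factors at
non-host parts only, so the extent law need only be displayed there: §3 `MρP_le_exp_sum_nhsum`,
`MρP_le_exp_of_nonhost_law` (gen 2's `HistoryJoinsRadius.MρP_le_exp_of_law` asks it at every part, host included —
too much for a potential that does not decay along the host spine).

WHAT.  §1 `nhsum st g X` (the sum of `g` over the NON-HOST parts of the top join of `X`; `0` off mergers),
`nhsum_nonneg`, `root_of_rootAddr_eq`, **`root_eq_host`** (the host part carries the root LABEL, not only the root
step).  §2 **`sum_joins_nhsum_root_add`**: `Σ_{X ∈ joins st G} nhsum st (g ∘ root) X + g (root G) = bsum g G`;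
`sum_joins_nhsum_root_le`.  §3 **`MρP_le_exp_sum_nhsum`**: `MρP ≤ exp(Σ_{X ∈ joins} nhsum (a + d·ext (ftime X) ·) X)`;
**`MρP_le_exp_of_nonhost_law`**: under `ext (ftime X) P ≤ C₀·φ (ftime X) P + c₀` at every NON-HOST part of every
join and `Σ_{joins} nhsum (φ (ftime X)) ≤ Φ`, `MρP ≤ exp((a + d·c₀)·(2·nmerges G) + d·C₀·Φ)`.

HONEST SCOPE.  Bookkeeping identities∕inequalities over OUR carriers; nothing of H3∕(B)∕BetaPertH touched; NE7b NOT
proved.  HONEST DEPENDENCY (cell): continuum YM on T⁴ ⇐ BetaPertH ∧ nine spine estimates (0/9 proved); BetaPertH ⇐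
(D1) ∧ (D4) ∧ CAP+tail; G-an2-4 gates asym, D1 and NE2/3/4.  This file changes none of it.
-/

open Finset
open Literature.MathematicalPhysics.QuantumFieldTheory.Balaban1983to89
open T4PersistenceDictionary T4PartnerMultiplicity T4BranchingRecordsGas T4BankedInduction
open Summit.QuantumFields.BalabanUV.T4Continuum.HistoryJoins
open Summit.QuantumFields.BalabanUV.T4Continuum.HistoryJoinsAdm
open Summit.QuantumFields.BalabanUV.T4Continuum.HistoryJoinsBudget
open Summit.QuantumFields.BalabanUV.T4Continuum.HistoryJoinsRadius
open Summit.QuantumFields.BalabanUV.T4Continuum.HistoryZoneMassJoins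
open Summit.QuantumFields.BalabanUV.T4Continuum.ZoneTorus
open Summit.QuantumFields.BalabanUV.T4Continuum.ZoneSkeleton

namespace Summit.QuantumFields.BalabanUV.T4Continuum.HistoryJoinsNonhost

noncomputable section
open scoped Classical

variable {ε : Type*} (st : ε → ℕ)

/-! ## §1 Non-host sums; the host carries the root label -/

/-- **THE NON-HOST SUM** of `g` over the parts of the top join of `X` (`0` unless `X` is a merger). [folklore] -/
def nhsum (g : Gen ε → ℝ) : Gen ε → ℝ
  | Gen.merge X Y e => ∑ i ∈ univ.filter (fun i => i ≠ hostIdx st X Y e), g (part st (Gen.merge X Y e) i).2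
  | _ => 0

/-- unfolding at a merger [folklore] -/
theorem nhsum_merge (g : Gen ε → ℝ) (X Y : Gen ε) (e : ε) :
    nhsum st g (Gen.merge X Y e) =
      ∑ i ∈ univ.filter (fun i => i ≠ hostIdx st X Y e), g (part st (Gen.merge X Y e) i).2 := rfl

/-- a non-host sum of nonnegative terms is nonnegative [folklore] -/
theorem nhsum_nonneg {g : Gen ε → ℝ} (hg : ∀ P, 0 ≤ g P) : ∀ X : Gen ε, 0 ≤ nhsum st g X
  | Gen.born _ _ => le_rfl
  | Gen.renew _ _ _ => le_rfl
  | Gen.merge _ _ _ => sum_nonneg fun _ _ => hg _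

/-- the whole-join sum splits into the host term and the non-host sum [folklore] -/
theorem sum_parts_eq_host_add_nhsum (g : Gen ε → ℝ) (X Y : Gen ε) (e : ε) :
    ∑ i, g (part st (Gen.merge X Y e) i).2 =
      g (part st (Gen.merge X Y e) (hostIdx st X Y e)).2 + nhsum st g (Gen.merge X Y e) := by
  rw [nhsum_merge, ← Finset.add_sum_erase univ (fun i => g (part st (Gen.merge X Y e) i).2)
    (mem_univ (hostIdx st X Y e)), filter_ne']

/-- **THE ROOT LABEL IS READ AT THE ROOT ADDRESS**: a cluster part whose path prolongs to the root address carries the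
root label. [folklore] -/
theorem root_of_rootAddr_eq (t : ℕ) :
    ∀ (G : Gen ε), ∀ q ∈ clusterParts st t G, rootAddr G = q.1 ++ rootAddr q.2 → G.root = q.2.root
  | Gen.born b j, q, hq, _ => by
      rw [clusterParts_born, List.mem_singleton] at hq
      subst hq; rfl
  | Gen.renew G e h, q, hq, _ => by
      rw [clusterParts_renew, List.mem_singleton] at hq
      subst hq; rfl
  | Gen.merge X Y e, q, hq, hr => by
      by_cases he : st e = t
      · rw [clusterParts_merge_of_eq st he, List.mem_append, List.mem_map, List.mem_map] at hq
        rw [root_merge]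
        simp only [rootAddr] at hr
        rcases hq with ⟨q', hq', rfl⟩ | ⟨q', hq', rfl⟩
        · split_ifs at hr with hXY
          · simp only [List.cons_append, List.cons.injEq, true_and] at hr
            rw [if_pos hXY]
            exact root_of_rootAddr_eq t X q' hq' hr
          · simp at hr
        · split_ifs at hr with hXY
          · simp at hr
          · simp only [List.cons_append, List.cons.injEq, true_and] at hr
            rw [if_neg hXY]
            exact root_of_rootAddr_eq t Y q' hq' hr
      · rw [clusterParts_merge_of_ne st he, List.mem_singleton] at hq
        subst hq; rfl

/-- **THE HOST CARRIES THE ROOT LABEL.** [folklore] -/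
theorem root_eq_host (X Y : Gen ε) (e : ε) :
    (Gen.merge X Y e).root = (part st (Gen.merge X Y e) (hostIdx st X Y e)).2.root :=
  root_of_rootAddr_eq st (st e) (Gen.merge X Y e) _ (part_mem st _ _) (rootAddr_eq_host st X Y e)

/-! ## §2 The non-host roots over all joins are the non-root births -/

/-- **`Σ_{X ∈ joins} nhsum (g ∘ root) X + g (root G) = bsum g G`** — every birth is the root of exactly one non-host
part (at the join absorbing its lineage) or the root of `G`. [folklore] -/
theorem sum_joins_nhsum_root_add (g : ε → ℝ) :
    ∀ G : Gen ε, ((joins st G).map (nhsum st fun P => g P.root)).sum + g G.root = bsum g G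
  | Gen.born b j => by simp [joins, croots, crootsP, bsum]
  | Gen.renew G e h => by
      have ih := sum_joins_nhsum_root_add g G
      simpa [joins, croots, crootsP, bsum] using ih
  | Gen.merge X Y e => by
      have ih : ∀ i : Fin (npart st (Gen.merge X Y e)),
          ((joins st (part st _ i).2).map (nhsum st fun P => g P.root)).sum =
            bsum g (part st _ i).2 - g (part st _ i).2.root := fun i => by
        have := sum_joins_nhsum_root_add g (part st (Gen.merge X Y e) i).2
        linarith
      rw [sum_joins_merge, ← sum_part_eq_sum_tparts st (Gen.merge X Y e)
        (fun P => ((joins st P).map (nhsum st fun P => g P.root)).sum), Finset.sum_congr rfl fun i _ => ih i,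
        sum_sub_distrib, sum_parts_eq_host_add_nhsum st (fun P => g P.root), ← root_eq_host,
        sum_part_eq_sum_tparts st (Gen.merge X Y e) (fun P => bsum g P), ← sum_jparts_eq_sum_tparts st (bsum g),
        show jparts st (Gen.merge X Y e) = clusterParts st (st e) (Gen.merge X Y e) from rfl,
        ← bsum_eq_sum_clusterParts st g (st e)]
      ring
termination_by G => gsize G
decreasing_by
  · simp [gsize]
  · exact gsize_lt_of_mem_jparts st _ _ (part_mem st _ i)

/-- hence for `g ≥ 0`: `Σ_{X ∈ joins} nhsum (g ∘ root) X ≤ bsum g G`. [folklore] -/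
theorem sum_joins_nhsum_root_le {g : ε → ℝ} (hg : ∀ b, 0 ≤ g b) (G : Gen ε) :
    ((joins st G).map (nhsum st fun P => g P.root)).sum ≤ bsum g G := by
  have h := sum_joins_nhsum_root_add st g G
  linarith [hg G.root]

/-! ## §3 The radius-factor product is over non-host parts -/

variable (ext : ℕ → Gen ε → ℝ) (Mρ : ℝ → ℝ)

/-- **`MρP ≤ exp(Σ_{X ∈ joins} nhsum (a + d·ext (ftime X) ·) X)`** for a radius factor of exponential type
`0 ≤ Mρ r ≤ exp(a + d·r)` and nonnegative extents — the NON-HOST form of gen 2's `MρP_le_exp_sum_joins`. [folklore] -/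
theorem MρP_le_exp_sum_nhsum {a d : ℝ} (hMρ0 : ∀ r, 0 ≤ Mρ r) (hMρ : ∀ r, 0 ≤ r → Mρ r ≤ Real.exp (a + d * r))
    (hext0 : ∀ t P, 0 ≤ ext t P) :
    ∀ G : Gen ε, MρP st ext Mρ G ≤
      Real.exp (((joins st G).map fun X => nhsum st (fun P => a + d * ext (ftime st X) P) X).sum)
  | Gen.born b j => by simp [MρP, joins, croots, crootsP]
  | Gen.renew G e h => by
      rw [MρP]
      have ih := MρP_le_exp_sum_nhsum hMρ0 hMρ hext0 G
      simpa [joins, croots, crootsP] using ih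
  | Gen.merge X Y e => by
      have ih : ∀ i : Fin (npart st (Gen.merge X Y e)), MρP st ext Mρ (part st _ i).2 ≤
          Real.exp (((joins st (part st _ i).2).map fun X' =>
            nhsum st (fun P => a + d * ext (ftime st X') P) X').sum) :=
        fun i => MρP_le_exp_sum_nhsum hMρ0 hMρ hext0 (part st _ i).2
      rw [MρP, sum_joins_merge, Real.exp_add]
      refine mul_le_mul ?_ ?_ (prod_nonneg fun i _ => MρP_nonneg st ext Mρ hMρ0 _) (Real.exp_pos _).le
      · -- the join's own non-host radius factors, EXACTLY
        have hft : ftime st (Gen.merge X Y e) = st e := rfl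
        rw [hft, nhsum_merge, Real.exp_sum,
          Finset.prod_subtype (univ.filter fun i => i ≠ hostIdx st X Y e) (p := fun i => i ≠ hostIdx st X Y e)
            (fun i => by simp) (fun i => Real.exp (a + d * ext (st e) (part st (Gen.merge X Y e) i).2))]
        exact prod_le_prod (fun i _ => hMρ0 _) fun i _ => hMρ _ (hext0 _ _)
      · calc ∏ i : Fin (npart st (Gen.merge X Y e)), MρP st ext Mρ (part st _ i).2
            ≤ ∏ i : Fin (npart st (Gen.merge X Y e)), Real.exp (((joins st (part st _ i).2).map fun X' =>
                nhsum st (fun P => a + d * ext (ftime st X') P) X').sum) :=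
              prod_le_prod (fun i _ => MρP_nonneg st ext Mρ hMρ0 _) fun i _ => ih i
          _ = _ := by
              rw [← Real.exp_sum, sum_part_eq_sum_tparts st (Gen.merge X Y e) fun Q =>
                ((joins st Q).map fun X' => nhsum st (fun P => a + d * ext (ftime st X') P) X').sum]
termination_by G => gsize G
decreasing_by
  · simp [gsize]
  · exact gsize_lt_of_mem_jparts st _ _ (part_mem st _ i)

/-- the number of non-host parts of a join is at most the number of its parts [folklore] -/
theorem nhsum_const_le (c : ℝ) (hc : 0 ≤ c) : ∀ X : Gen ε, nhsum st (fun _ => c) X ≤ c * (tparts st X).length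
  | Gen.born b j => by simp only [nhsum]; positivity
  | Gen.renew G e h => by simp only [nhsum]; positivity
  | Gen.merge X Y e => by
      rw [nhsum_merge, sum_const, nsmul_eq_mul, mul_comm]
      refine mul_le_mul_of_nonneg_left ?_ hc
      have h1 : ((univ.filter fun i => i ≠ hostIdx st X Y e).card : ℝ) ≤ (Fintype.card (Fin (npart st (Gen.merge X Y e))) : ℝ) := by
        exact_mod_cast (card_filter_le _ _).trans (card_univ (α := Fin (npart st (Gen.merge X Y e)))).le
      rw [Fintype.card_fin] at h1
      simpa [npart, tparts] using h1

/-- the non-host sum is additive and scales [folklore] -/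
theorem nhsum_add_mul (g h : Gen ε → ℝ) (a d : ℝ) (X : Gen ε) :
    nhsum st (fun P => a + d * (g P + h P)) X = nhsum st (fun _ => a) X + d * nhsum st g X + d * nhsum st h X := by
  cases X with
  | born b j => simp [nhsum]
  | renew G e k => simp [nhsum]
  | merge X Y e =>
      simp only [nhsum_merge, mul_sum, ← sum_add_distrib]
      exact sum_congr rfl fun i _ => by ring

/-- a non-host sum is dominated by the whole-parts list sum for nonnegative terms [folklore] -/
theorem nhsum_le_sum_tparts {g : Gen ε → ℝ} (hg : ∀ P, 0 ≤ g P) : ∀ X : Gen ε,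
    nhsum st g X ≤ ((tparts st X).map g).sum
  | Gen.born b j => by simp only [nhsum]; exact List.sum_nonneg (by intro x hx; obtain ⟨P, _, rfl⟩ := List.mem_map.1 hx; exact hg P)
  | Gen.renew G e h => by simp only [nhsum]; exact List.sum_nonneg (by intro x hx; obtain ⟨P, _, rfl⟩ := List.mem_map.1 hx; exact hg P)
  | Gen.merge X Y e => by
      rw [nhsum_merge, ← sum_part_eq_sum_tparts st (Gen.merge X Y e) g]
      exact sum_le_univ_sum_of_nonneg fun i => hg _

/-- **`MρP` UNDER THE EXTENT LAW DISPLAYED AT THE NON-HOST PARTS ONLY**: if at every join `X` every NON-HOST part `P`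
has `ext (ftime X) P ≤ C₀·φ (ftime X) P + c₀` (`C₀, c₀ ≥ 0`) and `Σ_{joins} nhsum (φ (ftime X)) X ≤ Φ`, then
`MρP ≤ exp((a + d·c₀)·(2·nmerges G) + d·C₀·Φ)`. [folklore] -/
theorem MρP_le_exp_of_nonhost_law {a d : ℝ} (ha : 0 ≤ a) (hd : 0 ≤ d) (hMρ0 : ∀ r, 0 ≤ Mρ r)
    (hMρ : ∀ r, 0 ≤ r → Mρ r ≤ Real.exp (a + d * r)) (hext0 : ∀ t P, 0 ≤ ext t P)
    {C₀ c₀ : ℝ} (hC₀ : 0 ≤ C₀) (hc₀ : 0 ≤ c₀) (φ : ℕ → Gen ε → ℝ) (G : Gen ε)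
    (hlaw : ∀ (X Y : Gen ε) (e : ε), Gen.merge X Y e ∈ joins st G → ∀ i, i ≠ hostIdx st X Y e →
      ext (st e) (part st (Gen.merge X Y e) i).2 ≤ C₀ * φ (st e) (part st (Gen.merge X Y e) i).2 + c₀)
    {Φ : ℝ} (hΦ : ((joins st G).map fun X => nhsum st (φ (ftime st X)) X).sum ≤ Φ) :
    MρP st ext Mρ G ≤ Real.exp ((a + d * c₀) * (2 * nmerges G) + d * C₀ * Φ) := by
  refine (MρP_le_exp_sum_nhsum st ext Mρ hMρ0 hMρ hext0 G).trans (Real.exp_le_exp.2 ?_)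
  -- pointwise at the non-host parts of each join
  have h1 : ((joins st G).map fun X => nhsum st (fun P => a + d * ext (ftime st X) P) X).sum ≤
      ((joins st G).map fun X => nhsum st (fun P => a + d * (C₀ * φ (ftime st X) P + c₀)) X).sum := by
    refine List.sum_le_sum fun X hX => ?_
    obtain ⟨A, B, e, rfl⟩ : ∃ A B e, X = Gen.merge A B e := by
      rw [joins, List.mem_map] at hX
      obtain ⟨q, hq, rfl⟩ := hX
      obtain ⟨A, B, e, h⟩ := exists_eq_merge_of_mem_crootsP st none G q hq
      exact ⟨A, B, e, h⟩
    rw [nhsum_merge, nhsum_merge]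
    refine sum_le_sum fun i hi => ?_
    have := hlaw A B e hX i (mem_filter.1 hi).2
    have hft : ftime st (Gen.merge A B e) = st e := rfl
    rw [hft]
    nlinarith
  refine h1.trans ?_
  -- split the affine form: constants against `2·nmerges`, the potential against `Φ`
  have h2 : ((joins st G).map fun X => nhsum st (fun P => a + d * (C₀ * φ (ftime st X) P + c₀)) X).sum =
      ((joins st G).map fun X => nhsum st (fun _ => a + d * c₀) X).sum +
        d * C₀ * ((joins st G).map fun X => nhsum st (φ (ftime st X)) X).sum := by
    induction joins st G with
    | nil => simp
    | cons X l ihl =>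
        simp only [List.map_cons, List.sum_cons]
        rw [ihl]
        have hX : nhsum st (fun P => a + d * (C₀ * φ (ftime st X) P + c₀)) X =
            nhsum st (fun _ => a + d * c₀) X + d * C₀ * nhsum st (φ (ftime st X)) X := by
          cases X with
          | born b j => simp [nhsum]
          | renew G' e k => simp [nhsum]
          | merge A B e =>
              simp only [nhsum_merge, mul_sum, ← sum_add_distrib]
              exact sum_congr rfl fun i _ => by ring
        rw [hX]; ring
  rw [h2]
  have h3 : ((joins st G).map fun X => nhsum st (fun _ => a + d * c₀) X).sum ≤
      (a + d * c₀) * (2 * (nmerges G : ℝ)) := by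
    have hc : 0 ≤ a + d * c₀ := by positivity
    have hl : ∀ l : List (Gen ε), (l.map fun X => nhsum st (fun _ => a + d * c₀) X).sum ≤
        (a + d * c₀) * ((l.map fun X => (tparts st X).length).sum : ℝ) := by
      intro l
      induction l with
      | nil => simp
      | cons X l ihl =>
          simp only [List.map_cons, List.sum_cons, Nat.cast_add]
          have := nhsum_const_le st _ hc X
          nlinarith
    refine (hl _).trans (mul_le_mul_of_nonneg_left ?_ hc)
    exact_mod_cast sum_length_tparts_le st G
  nlinarith [mul_nonneg hd hC₀]

end

end Summit.QuantumFields.BalabanUV.T4Continuum.HistoryJoinsNonhost
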